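import Mathlib
import Summits.CriticalPhenomena.PercolationContinuityZ3.Theorems.QuantitativeBGN.Negative.LoadBearing
import Literature.Probability.Percolation.SharpnessDCTProofs
import Literature.Probability.Percolation.FiniteEnergy
import Literature.Probability.Percolation.ConstrainedClusters
import Literature.Probability.Percolation.HalfSpacePinnedPairs
import HarnessLib

/-!
# Stub stub_shellSubmult of line registered (crux HalfSpaceOneArmRate, stmt-CriticalPhenomena-6983)

Registered stub `stub_shellSubmult` of the lead's skeleton `Cruxes/HalfSpaceOneArmRate/Lines/birth.lean`
(route `PercBoundarySqueeze`, crux `HalfSpaceOneArmRate`): **half-space arm submultiplicativity across a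
shell**. For every density `p` and `1 ≤ r < R`,

  `P_p(arm_H(0,R)) ≤ P_p(arm_H(0,r)) · P_p(ShellCross_H(r,R))`,

where `arm_H(0,r) = armH r = {∃ y, ‖y‖∞ ≥ r, 0 ↔ y open inside H}`, `H = {x | 0 ≤ x 0}`, and
`ShellCross_H(r,R) = {∃ w y, ‖w‖∞ ≤ r+1, ‖y‖∞ ≥ R, w ↔ y open inside H ∩ {‖x‖∞ > r}}` (spelled out
verbatim in the statement).

Proof (Grimmett 1999 §2.2 style, elementary): on configurations `ω ⊆ E(ℤ³)` (a sure event,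
`DCT16.real_mono_of_forall_subset_edgeSet`) an open `H`-path from `0` to sup-distance `≥ R` gives
* by its FIRST exit from the open cube `{‖x‖∞ < r}` (`PathIn.exit`) an open `H`-path inside `Λ_r` from
  `0` to a vertex of sup-norm `≥ r` — the INNER ARM event, contained in `armH r` and determined by the
  pairs inside `Λ_r`;
* by its LAST exit from `Λ_r` (`PathIn.last_exit`) an open path inside `H ∖ Λ_r = H ∩ {‖x‖∞ > r}` from a
  vertex of `Λ_{r+1}` to the endpoint — the SHELL-CROSSING event, determined by the pairs inside
  `H ∖ Λ_r`.
The two determining sets of pairs are disjoint, so the events are independent under the product measure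
(`bondPercolation_real_inter_of_disjoint`), and monotonicity finishes.

No new definitions: the two events are written inline throughout (helper namespace `StubShellSubmult`).
-/

noncomputable section

namespace Summit.CriticalPhenomena.PercolationContinuityZ3.Theorems

open MeasureTheory
open Literature.Probability.Percolation Literature.Probability.LatticeModels
open Summit.CriticalPhenomena.PercolationContinuityZ3.Theorems.QuantitativeBGN.Negative
  (armH armH_antitone zero_mem_H measurableSet_armH)

namespace StubShellSubmult

/-! ## Path surgery on lattice configurations -/

/-- **Inner arm.** For `ω ⊆ E(ℤ³)` and `1 ≤ r`, an open `H`-path from `0` to sup-norm `≥ r` contains,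
up to its first exit from the open cube `{‖x‖∞ < r}`, an open path inside `H ∩ Λ_r` from `0` to a
vertex of sup-norm `≥ r`. [folklore] -/
theorem inner_arm {ω : BondConfig (Site 3)} (hω : ω ⊆ (zdGraph 3).edgeSet) {r : ℕ} (hr : 1 ≤ r)
    {y : Site 3} (hy : ∃ i : Fin 3, (r : ℤ) ≤ |y i|)
    (hp : PathIn (openGraph ω) {x : Site 3 | 0 ≤ x 0} 0 y) :
    ∃ y' : Site 3, (∃ i : Fin 3, (r : ℤ) ≤ |y' i|) ∧
      PathIn (openGraph ω) ({x : Site 3 | 0 ≤ x 0} ∩ ↑(box 3 r)) 0 y' := by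
  have h0 : (0 : Site 3) ∈ {x : Site 3 | ∀ i : Fin 3, |x i| < (r : ℤ)} := by
    simp only [Set.mem_setOf_eq, Pi.zero_apply, abs_zero]
    intro i
    exact_mod_cast hr
  have hyR : y ∉ {x : Site 3 | ∀ i : Fin 3, |x i| < (r : ℤ)} := by
    obtain ⟨i, hi⟩ := hy
    intro h
    exact absurd (h i) (not_lt.2 hi)
  obtain ⟨a, b, ha, hb, hbH, hab, hpa⟩ := hp.exit h0 hyR
  have hab' : (zdGraph 3).Adj a b := DCT16.adj_of_openGraph_adj hω hab
  have hbbox : b ∈ (↑(box 3 r) : Set (Site 3)) := by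
    rw [Finset.mem_coe, mem_box]
    intro i
    have h1 := DCT16.abs_sub_le_one_of_adj hab' i
    have h2 : |a i| < (r : ℤ) := ha i
    rw [abs_le] at h1
    rw [abs_lt] at h2
    omega
  have hbi : ∃ i : Fin 3, (r : ℤ) ≤ |b i| := by
    simp only [Set.mem_setOf_eq, not_forall, not_lt] at hb
    exact hb
  refine ⟨b, hbi, ?_⟩
  have hsub : {x : Site 3 | ∀ i : Fin 3, |x i| < (r : ℤ)} ∩ {x : Site 3 | 0 ≤ x 0} ⊆
      {x : Site 3 | 0 ≤ x 0} ∩ ↑(box 3 r) := by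
    rintro x ⟨hx1, hx2⟩
    refine ⟨hx2, ?_⟩
    rw [Finset.mem_coe, mem_box]
    intro i
    have h3 : |x i| < (r : ℤ) := hx1 i
    rw [abs_lt] at h3
    omega
  exact (hpa.mono hsub).tail hab ⟨hbH, hbbox⟩

/-- **Outer crossing.** For `ω ⊆ E(ℤ³)` and `r < R`, an open `H`-path from `0` to sup-norm `≥ R`
contains, after its last exit from `Λ_r`, an open path inside `H ∩ {‖x‖∞ > r}` from a vertex of
`Λ_{r+1}` to its endpoint. [folklore] -/
theorem outer_cross {ω : BondConfig (Site 3)} (hω : ω ⊆ (zdGraph 3).edgeSet) {r R : ℕ} (hrR : r < R)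
    {y : Site 3} (hy : ∃ i : Fin 3, (R : ℤ) ≤ |y i|)
    (hp : PathIn (openGraph ω) {x : Site 3 | 0 ≤ x 0} 0 y) :
    ∃ w : Site 3, (∀ i : Fin 3, |w i| ≤ (r : ℤ) + 1) ∧
      PathIn (openGraph ω) {x : Site 3 | 0 ≤ x 0 ∧ ∃ i : Fin 3, (r : ℤ) < |x i|} w y := by
  have h0 : (0 : Site 3) ∈ (↑(box 3 r) : Set (Site 3)) := Finset.mem_coe.2 (zero_mem_box 3 r)
  have hyC : y ∉ (↑(box 3 r) : Set (Site 3)) := by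
    obtain ⟨i, hi⟩ := hy
    rw [Finset.mem_coe, mem_box, not_forall]
    refine ⟨i, fun h => ?_⟩
    rw [le_abs] at hi
    omega
  obtain ⟨a, b, haC, -, -, hab, hpb⟩ := hp.last_exit h0 hyC
  have hab' : (zdGraph 3).Adj a b := DCT16.adj_of_openGraph_adj hω hab
  have hb : b ∈ box 3 (r + 1) := DCT16.mem_box_succ_of_adj (Finset.mem_coe.1 haC) hab'
  refine ⟨b, ?_, hpb.mono ?_⟩
  · intro i
    rw [mem_box] at hb
    have h1 := hb i
    push_cast at h1
    exact abs_le.2 h1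
  · rintro x ⟨hxH, hxC⟩
    refine ⟨hxH, ?_⟩
    rw [Finset.mem_coe, mem_box, not_forall] at hxC
    obtain ⟨i, hi⟩ := hxC
    refine ⟨i, ?_⟩
    rw [lt_abs]
    omega

/-- For `ω ⊆ E(ℤ³)` and `1 ≤ r < R`: `arm_H(0,R) ⊆ InnerArm(r) ∩ ShellCross_H(r,R)`. [folklore] -/
theorem mem_inter_of_mem_armH {ω : BondConfig (Site 3)} (hω : ω ⊆ (zdGraph 3).edgeSet) {r R : ℕ}
    (hr : 1 ≤ r) (hrR : r < R) (h : ω ∈ armH R) :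
    ω ∈ {ω : BondConfig (Site 3) | ∃ y : Site 3, (∃ i : Fin 3, (r : ℤ) ≤ |y i|) ∧
        ω ∈ openConnIn ({x : Site 3 | 0 ≤ x 0} ∩ ↑(box 3 r)) 0 y} ∩
      {ω | ∃ w y : Site 3, (∀ i : Fin 3, |w i| ≤ (r : ℤ) + 1) ∧ (∃ i : Fin 3, (R : ℤ) ≤ |y i|) ∧
        ω ∈ openConnIn {x : Site 3 | 0 ≤ x 0 ∧ ∃ i : Fin 3, (r : ℤ) < |x i|} w y} := by
  obtain ⟨y, hy, hconn⟩ := h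
  have hp := DCT16.mem_openConnIn_iff_pathIn.1 hconn
  have hy' : ∃ i : Fin 3, (r : ℤ) ≤ |y i| := by
    obtain ⟨i, hi⟩ := hy
    exact ⟨i, le_trans (by exact_mod_cast hrR.le) hi⟩
  refine ⟨?_, ?_⟩
  · obtain ⟨y', hy'', hp'⟩ := inner_arm hω hr hy' hp
    exact ⟨y', hy'', DCT16.mem_openConnIn_iff_pathIn.2 hp'⟩
  · obtain ⟨w, hw, hp'⟩ := outer_cross hω hrR hy hp
    exact ⟨w, y, hw, hy, DCT16.mem_openConnIn_iff_pathIn.2 hp'⟩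

/-- The inner arm event is contained in `arm_H(0,r)` (`H ∩ Λ_r ⊆ H`). [folklore] -/
theorem inner_subset_armH (r : ℕ) :
    {ω : BondConfig (Site 3) | ∃ y : Site 3, (∃ i : Fin 3, (r : ℤ) ≤ |y i|) ∧
        ω ∈ openConnIn ({x : Site 3 | 0 ≤ x 0} ∩ ↑(box 3 r)) 0 y} ⊆ armH r := by
  rintro ω ⟨y, hy, hω⟩
  exact ⟨y, hy, DCT16.mem_openConnIn_iff_pathIn.2
    ((DCT16.mem_openConnIn_iff_pathIn.1 hω).mono Set.inter_subset_left)⟩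

/-! ## Determining sets of pairs, their disjointness, measurability -/

/-- The inner arm event as a countable union of connection events. [folklore] -/
theorem inner_eq_iUnion (r : ℕ) :
    {ω : BondConfig (Site 3) | ∃ y : Site 3, (∃ i : Fin 3, (r : ℤ) ≤ |y i|) ∧
        ω ∈ openConnIn ({x : Site 3 | 0 ≤ x 0} ∩ ↑(box 3 r)) 0 y} =
      ⋃ y ∈ {y : Site 3 | ∃ i : Fin 3, (r : ℤ) ≤ |y i|},
        openConnIn ({x : Site 3 | 0 ≤ x 0} ∩ ↑(box 3 r)) 0 y := by
  ext ω
  simp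

/-- The shell-crossing event as a countable union of connection events. [folklore] -/
theorem outer_eq_iUnion (r R : ℕ) :
    {ω : BondConfig (Site 3) | ∃ w y : Site 3, (∀ i : Fin 3, |w i| ≤ (r : ℤ) + 1) ∧
        (∃ i : Fin 3, (R : ℤ) ≤ |y i|) ∧
        ω ∈ openConnIn {x : Site 3 | 0 ≤ x 0 ∧ ∃ i : Fin 3, (r : ℤ) < |x i|} w y} =
      ⋃ w ∈ {w : Site 3 | ∀ i : Fin 3, |w i| ≤ (r : ℤ) + 1},
        ⋃ y ∈ {y : Site 3 | ∃ i : Fin 3, (R : ℤ) ≤ |y i|},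
          openConnIn {x : Site 3 | 0 ≤ x 0 ∧ ∃ i : Fin 3, (r : ℤ) < |x i|} w y := by
  ext ω
  simp

/-- **The inner arm event is determined by the pairs inside `Λ_r`.** [folklore] -/
theorem determinedBy_inner (r : ℕ) :
    DeterminedBy {ω : BondConfig (Site 3) | ∃ y : Site 3, (∃ i : Fin 3, (r : ℤ) ≤ |y i|) ∧
        ω ∈ openConnIn ({x : Site 3 | 0 ≤ x 0} ∩ ↑(box 3 r)) 0 y}
      (↑((box 3 r).sym2) : Set (Sym2 (Site 3))) := by
  rw [inner_eq_iUnion]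
  refine DeterminedBy.iUnion fun y => DeterminedBy.iUnion fun _ => ?_
  refine DCT16.determinedBy_openConnIn _ 0 y ?_
  rw [Finset.coe_sym2]
  intro z hz
  induction z using Sym2.ind with
  | h a b =>
    rw [Set.mk_mem_sym2_iff] at hz ⊢
    exact ⟨hz.1.2, hz.2.2⟩

/-- **The shell-crossing event is determined by the pairs inside `H ∩ {‖x‖∞ > r}`.** [folklore] -/
theorem determinedBy_outer (r R : ℕ) :
    DeterminedBy {ω : BondConfig (Site 3) | ∃ w y : Site 3, (∀ i : Fin 3, |w i| ≤ (r : ℤ) + 1) ∧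
        (∃ i : Fin 3, (R : ℤ) ≤ |y i|) ∧
        ω ∈ openConnIn {x : Site 3 | 0 ≤ x 0 ∧ ∃ i : Fin 3, (r : ℤ) < |x i|} w y}
      (Set.sym2 {x : Site 3 | 0 ≤ x 0 ∧ ∃ i : Fin 3, (r : ℤ) < |x i|}) := by
  rw [outer_eq_iUnion]
  exact DeterminedBy.iUnion fun w => DeterminedBy.iUnion fun _ =>
    DeterminedBy.iUnion fun y => DeterminedBy.iUnion fun _ =>
      DCT16.determinedBy_openConnIn _ w y subset_rfl

/-- The two determining sets of pairs are disjoint: a pair inside `Λ_r` has no endpoint of sup-norm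
`> r`. [folklore] -/
theorem disjoint_sym2 (r : ℕ) :
    Disjoint (↑((box 3 r).sym2) : Set (Sym2 (Site 3)))
      (Set.sym2 {x : Site 3 | 0 ≤ x 0 ∧ ∃ i : Fin 3, (r : ℤ) < |x i|}) := by
  rw [Finset.coe_sym2, Set.disjoint_left]
  intro z hz hz'
  induction z using Sym2.ind with
  | h a b =>
    rw [Set.mk_mem_sym2_iff] at hz hz'
    obtain ⟨i, hi⟩ := hz'.1.2
    have ha := (mem_box.1 (Finset.mem_coe.1 hz.1)) i
    rw [lt_abs] at hi
    omega

/-- The inner arm event is measurable (finitely determined). [folklore] -/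
theorem measurableSet_inner (r : ℕ) :
    MeasurableSet {ω : BondConfig (Site 3) | ∃ y : Site 3, (∃ i : Fin 3, (r : ℤ) ≤ |y i|) ∧
        ω ∈ openConnIn ({x : Site 3 | 0 ≤ x 0} ∩ ↑(box 3 r)) 0 y} :=
  (determinedBy_inner r).measurableSet_of_finset

/-- The shell-crossing event is measurable (a countable union of connection events). [folklore] -/
theorem measurableSet_outer (r R : ℕ) :
    MeasurableSet {ω : BondConfig (Site 3) | ∃ w y : Site 3, (∀ i : Fin 3, |w i| ≤ (r : ℤ) + 1) ∧
        (∃ i : Fin 3, (R : ℤ) ≤ |y i|) ∧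
        ω ∈ openConnIn {x : Site 3 | 0 ≤ x 0 ∧ ∃ i : Fin 3, (r : ℤ) < |x i|} w y} := by
  rw [outer_eq_iUnion]
  exact MeasurableSet.biUnion (Set.to_countable _) fun w _ =>
    MeasurableSet.biUnion (Set.to_countable _) fun y _ => measurableSet_openConnIn_of_countable _ w y

end StubShellSubmult

/-- **stub_shellSubmult (half-space arm submultiplicativity across a shell).** For every density `p`
and `1 ≤ r < R`, `P_p(arm_H(0,R)) ≤ P_p(arm_H(0,r)) · P_p(ShellCross_H(r,R))`: last-exit / first-exit
decomposition of an open `H`-path at `Λ_r` (`StubShellSubmult.mem_inter_of_mem_armH`) and independence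
of events determined by disjoint sets of pairs under the product measure
(`bondPercolation_real_inter_of_disjoint`), then `InnerArm(r) ⊆ arm_H(0,r)`. [folklore] -/
theorem stub_shellSubmult : ∀ p : unitInterval, ∀ r R : ℕ, 1 ≤ r → r < R →
    (bondPercolation (zdGraph 3) p).real (armH R) ≤
      (bondPercolation (zdGraph 3) p).real (armH r) *
        (bondPercolation (zdGraph 3) p).real
          {ω | ∃ w y : Site 3, (∀ i : Fin 3, |w i| ≤ (r : ℤ) + 1) ∧ (∃ i : Fin 3, (R : ℤ) ≤ |y i|) ∧
            ω ∈ openConnIn {x : Site 3 | 0 ≤ x 0 ∧ ∃ i : Fin 3, (r : ℤ) < |x i|} w y} := by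
  intro p r R hr hrR
  have h1 := DCT16.real_mono_of_forall_subset_edgeSet (zdGraph 3) p
    (fun ω hω hA => StubShellSubmult.mem_inter_of_mem_armH hω hr hrR hA)
  rw [bondPercolation_real_inter_of_disjoint (zdGraph 3) p (StubShellSubmult.disjoint_sym2 r)
    (StubShellSubmult.determinedBy_inner r) (StubShellSubmult.determinedBy_outer r R)
    (StubShellSubmult.measurableSet_inner r) (StubShellSubmult.measurableSet_outer r R)] at h1
  exact h1.trans (mul_le_mul_of_nonneg_right
    (measureReal_mono (StubShellSubmult.inner_subset_armH r)) measureReal_nonneg)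

end Summit.CriticalPhenomena.PercolationContinuityZ3.Theorems

end
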